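import Mathlib.MeasureTheory.Integral.IntervalIntegral.IntegrationByParts
import Mathlib.Analysis.SpecialFunctions.Integrals.Basic
import Mathlib.Analysis.Complex.Trigonometric
import HarnessLib

/-!
# Oscillatory integrals with a linear phase: the integration-by-parts bound
# `‖∫ₐᵇ e^{iλs} A(s) ds‖ ≤ (|A(a)| + |A(b)| + ∫ₐᵇ|A′|)/|λ|` and the detuned `cos(ωs)e^{iφs}` response

Analysis/Fourier proof file (theorems only; no definitions, no named facts). The `k = 1` (non-stationary,
linear phase) case of van der Corput's lemma with an amplitude (Grafakos, Prop. 2.6.7 (c) / Cor. 2.6.8):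
one integration by parts against the antiderivative `e^{iλs}/(iλ)`.

* `LinearPhase.norm_integral_exp_mul_le` — for `λ ≠ 0`, `a ≤ b`, `A ∈ C¹`:
  `‖∫ₐᵇ e^{iλs} A(s) ds‖ ≤ (‖A a‖ + ‖A b‖ + ∫ₐᵇ ‖A′‖)/|λ|`.
* `LinearPhase.norm_integral_cos_mul_exp_mul_le` — **the detuned forced response of a stable block**:
  for `0 < Δ ≤ |φ| − |ω|`, `θ ≥ 0`,
  `‖∫₀^θ cos(ωs) e^{iφs} A(s) ds‖ ≤ (2 sup_{[0,θ]}‖A‖ + ∫₀^θ‖A′‖)/Δ`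
  (`cos(ωs)e^{iφs} = ½(e^{i(φ+ω)s} + e^{i(φ−ω)s})`, both frequencies `≥ Δ` in modulus) — uniformly in the
  length `θ` of the window: the response of an oscillator of frequency `ω` to a forcing at frequency `φ`
  detuned by `Δ` is controlled by the envelope's size and total variation over the detuning. Stated in
  the binder shape of `K2Cone.OscillatoryDuhamelBound` (cell `ad-ideate`, `Cruxes/K1LocalisedCascade/K2ConeSketch.lean`);
  `LinearPhase.norm_integral_sin_mul_exp_mul_le` — the `sin(ωs)` companion (same bound).

## References

* L. Grafakos, *Classical Fourier Analysis*, 3rd ed., GTM 249, Springer (2014), §2.6.2 Prop. 2.6.7 (c)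
  and Cor. 2.6.8 (case `k = 1`) with their proofs (held: `book:grafakos2014-classical-fourier-analysis`,
  PDF pp. 179–180). [`Grafakos2014`]
-/

noncomputable section

open Set MeasureTheory intervalIntegral Complex

namespace Literature.Analysis.Fourier

namespace LinearPhase

/-- The antiderivative of the linear-phase character: `d/ds (e^{iλs}/(iλ)) = e^{iλs}` (`λ ≠ 0`).
[cite: Grafakos2014, Prop. 2.6.7 (c) (proof: (e^{iλu})′/(iλu′))] -/
theorem hasDerivAt_exp_mul_I_div {l : ℝ} (hl : l ≠ 0) (s : ℝ) :
    HasDerivAt (fun s : ℝ => Complex.exp ((l * s : ℝ) * Complex.I) / ((l : ℂ) * Complex.I))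
      (Complex.exp ((l * s : ℝ) * Complex.I)) s := by
  have h1 : HasDerivAt (fun s : ℝ => ((l * s : ℝ) : ℂ) * Complex.I) (((l * 1 : ℝ) : ℂ) * Complex.I) s :=
    (((hasDerivAt_id s).const_mul l).ofReal_comp).mul_const Complex.I
  have h2 := (h1.cexp).div_const ((l : ℂ) * Complex.I)
  refine h2.congr_deriv ?_
  have hl' : (l : ℂ) ≠ 0 := Complex.ofReal_ne_zero.2 hl
  have hlI : (l : ℂ) * Complex.I ≠ 0 := mul_ne_zero hl' Complex.I_ne_zero
  rw [mul_one]
  field_simp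

/-- `‖e^{iλs}/(iλ)‖ = 1/|λ|`. [cite: Grafakos2014, Prop. 2.6.7 (c) (proof)] -/
theorem norm_exp_mul_I_div {l : ℝ} (s : ℝ) :
    ‖Complex.exp ((l * s : ℝ) * Complex.I) / ((l : ℂ) * Complex.I)‖ = 1 / |l| := by
  rw [norm_div, Complex.norm_exp_ofReal_mul_I, norm_mul, Complex.norm_I, mul_one, Complex.norm_real,
    Real.norm_eq_abs]

/-- A function with a derivative everywhere is continuous. [folklore] -/
private theorem continuous_of_hasDerivAt {A A' : ℝ → ℂ} (hA : ∀ s, HasDerivAt A (A' s) s) : Continuous A :=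
  continuous_iff_continuousAt.2 fun s => (hA s).continuousAt

/-- **Linear-phase oscillatory integral, one integration by parts** (van der Corput `k = 1` with an
amplitude, linear phase): for `λ ≠ 0`, `a ≤ b` and `A ∈ C¹` (derivative `A′` continuous),
`‖∫ₐᵇ e^{iλs} A(s) ds‖ ≤ (‖A a‖ + ‖A b‖ + ∫ₐᵇ ‖A′(s)‖ ds)/|λ|`.
[cite: Grafakos2014, Cor. 2.6.8 (k = 1: |∫ e^{iλu}ψ| ≤ 3λ⁻¹[|ψ(b)| + ∫|ψ′|]; linear phase u(t) = t)] -/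
theorem norm_integral_exp_mul_le {l a b : ℝ} (hl : l ≠ 0) (hab : a ≤ b) {A A' : ℝ → ℂ}
    (hA : ∀ s, HasDerivAt A (A' s) s) (hA' : Continuous A') :
    ‖∫ s in a..b, Complex.exp ((l * s : ℝ) * Complex.I) * A s‖ ≤
      (‖A a‖ + ‖A b‖ + ∫ s in a..b, ‖A' s‖) / |l| := by
  set e : ℝ → ℂ := fun s => Complex.exp ((l * s : ℝ) * Complex.I) / ((l : ℂ) * Complex.I) with he
  have hed : ∀ s, HasDerivAt e (Complex.exp ((l * s : ℝ) * Complex.I)) s := fun s =>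
    hasDerivAt_exp_mul_I_div hl s
  have hcexp : Continuous fun s : ℝ => Complex.exp ((l * s : ℝ) * Complex.I) :=
    Complex.continuous_exp.comp ((Complex.continuous_ofReal.comp (continuous_const.mul continuous_id)).mul
      continuous_const)
  have hec : Continuous e := hcexp.div_const _
  -- integration by parts: `∫ A · e' = A b e b − A a e a − ∫ A' e`
  have hparts := intervalIntegral.integral_mul_deriv_eq_deriv_mul (a := a) (b := b) (u := A) (v := e) (u' := A')
    (v' := fun s => Complex.exp ((l * s : ℝ) * Complex.I))
    (fun s _ => hA s) (fun s _ => hed s) (hA'.intervalIntegrable a b) (hcexp.intervalIntegrable a b)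
  have e1 : ∫ s in a..b, Complex.exp ((l * s : ℝ) * Complex.I) * A s =
      A b * e b - A a * e a - ∫ s in a..b, A' s * e s := by
    rw [← hparts]
    exact intervalIntegral.integral_congr fun s _ => by ring
  rw [e1]
  have hl0 : 0 < |l| := abs_pos.2 hl
  have hn : ∀ s, ‖e s‖ = 1 / |l| := fun s => norm_exp_mul_I_div s
  have hI : ‖∫ s in a..b, A' s * e s‖ ≤ (∫ s in a..b, ‖A' s‖) / |l| := by
    calc ‖∫ s in a..b, A' s * e s‖ ≤ ∫ s in a..b, ‖A' s * e s‖ :=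
          intervalIntegral.norm_integral_le_integral_norm hab
      _ = ∫ s in a..b, ‖A' s‖ * (1 / |l|) :=
          intervalIntegral.integral_congr fun s _ => by simp only [norm_mul, hn]
      _ = (∫ s in a..b, ‖A' s‖) / |l| := by
          rw [intervalIntegral.integral_mul_const]; ring
  calc ‖A b * e b - A a * e a - ∫ s in a..b, A' s * e s‖
      ≤ ‖A b * e b‖ + ‖A a * e a‖ + ‖∫ s in a..b, A' s * e s‖ := by
        refine (norm_sub_le _ _).trans (add_le_add (norm_sub_le _ _) le_rfl)
    _ ≤ ‖A b‖ * (1 / |l|) + ‖A a‖ * (1 / |l|) + (∫ s in a..b, ‖A' s‖) / |l| := by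
        rw [norm_mul, norm_mul, hn, hn]
        exact add_le_add le_rfl hI
    _ = (‖A a‖ + ‖A b‖ + ∫ s in a..b, ‖A' s‖) / |l| := by ring

/-- The supremum `⨆ s ∈ [0,θ], ‖A s‖` of a continuous amplitude bounds its values on `[0,θ]`. [folklore] -/
private theorem norm_le_biSup {A : ℝ → ℂ} (hA : Continuous A) {θ s : ℝ} (hs : s ∈ Icc (0 : ℝ) θ) :
    ‖A s‖ ≤ ⨆ s ∈ Icc (0 : ℝ) θ, ‖A s‖ := by
  obtain ⟨M, hM⟩ := (isCompact_Icc (a := (0 : ℝ)) (b := θ)).bddAbove_image hA.norm.continuousOn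
  have hbdd : BddAbove (range fun s => ⨆ (_ : s ∈ Icc (0 : ℝ) θ), ‖A s‖) := by
    refine ⟨max M 0, ?_⟩
    rintro _ ⟨t, rfl⟩
    by_cases ht : t ∈ Icc (0 : ℝ) θ
    · simp only [ciSup_pos ht]
      exact (hM ⟨t, ht, rfl⟩).trans (le_max_left _ _)
    · simp only [ht]
      rw [Real.iSup_of_isEmpty]
      exact le_max_right _ _
  have h := le_ciSup hbdd s
  simp only [ciSup_pos hs] at h
  exact h

/-- **The detuned `cos`-oscillator response** (the generic stable-block forced-response lemma): for
`0 < Δ ≤ |φ| − |ω|`, `θ ≥ 0` and a `C¹` envelope `A`,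
`‖∫₀^θ cos(ωs) e^{iφs} A(s) ds‖ ≤ (2 sup_{s∈[0,θ]}‖A s‖ + ∫₀^θ ‖A′‖)/Δ`: write
`cos(ωs)e^{iφs} = ½(e^{i(φ+ω)s} + e^{i(φ−ω)s})`, `|φ ± ω| ≥ |φ| − |ω| ≥ Δ`, and apply
`norm_integral_exp_mul_le` to each half. Binder shape = `K2Cone.OscillatoryDuhamelBound`.
[cite: Grafakos2014, Cor. 2.6.8 (k = 1) applied to the two linear phases (φ ± ω)s] -/
theorem norm_integral_cos_mul_exp_mul_le :
    ∀ (ω φ Δ θ : ℝ) (A : ℝ → ℂ) (A' : ℝ → ℂ), 0 < Δ → 0 ≤ θ → Δ ≤ |φ| - |ω| →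
      (∀ s, HasDerivAt A (A' s) s) → Continuous A' →
        ‖∫ s in (0 : ℝ)..θ, (Real.cos (ω * s) : ℂ) * Complex.exp ((φ * s : ℝ) * Complex.I) * A s‖
          ≤ (2 * (⨆ s ∈ Set.Icc (0 : ℝ) θ, ‖A s‖) + ∫ s in (0 : ℝ)..θ, ‖A' s‖) / Δ := by
  intro ω φ Δ θ A A' hΔ hθ hdet hA hA'
  have hAc : Continuous A := continuous_of_hasDerivAt hA
  -- the two detuned frequencies
  have hp : Δ ≤ |φ + ω| := hdet.trans (by simpa using abs_sub_abs_le_abs_sub φ (-ω))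
  have hm : Δ ≤ |φ - ω| := hdet.trans (abs_sub_abs_le_abs_sub φ ω)
  have hp0 : φ + ω ≠ 0 := fun h => by rw [h, abs_zero] at hp; linarith
  have hm0 : φ - ω ≠ 0 := fun h => by rw [h, abs_zero] at hm; linarith
  -- `cos(ωs) e^{iφs} A = ½ e^{i(φ+ω)s} A + ½ e^{i(φ−ω)s} A`
  have hsplit : ∀ s : ℝ, (Real.cos (ω * s) : ℂ) * Complex.exp ((φ * s : ℝ) * Complex.I) * A s =
      (1 / 2 : ℂ) * (Complex.exp (((φ + ω) * s : ℝ) * Complex.I) * A s) +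
        (1 / 2 : ℂ) * (Complex.exp (((φ - ω) * s : ℝ) * Complex.I) * A s) := by
    intro s
    have hc : (Real.cos (ω * s) : ℂ) = (Complex.exp ((ω * s : ℝ) * Complex.I) +
        Complex.exp (-((ω * s : ℝ) : ℂ) * Complex.I)) / 2 := by
      rw [Complex.ofReal_cos, ← Complex.two_cos]; ring
    rw [hc]
    have e1 : Complex.exp (((φ + ω) * s : ℝ) * Complex.I) =
        Complex.exp ((ω * s : ℝ) * Complex.I) * Complex.exp ((φ * s : ℝ) * Complex.I) := by
      rw [← Complex.exp_add]; push_cast; ring_nf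
    have e2 : Complex.exp (((φ - ω) * s : ℝ) * Complex.I) =
        Complex.exp (-((ω * s : ℝ) : ℂ) * Complex.I) * Complex.exp ((φ * s : ℝ) * Complex.I) := by
      rw [← Complex.exp_add]; push_cast; ring_nf
    rw [e1, e2]; ring
  have hi1 : IntervalIntegrable (fun s => Complex.exp (((φ + ω) * s : ℝ) * Complex.I) * A s) volume 0 θ :=
    ((Complex.continuous_exp.comp ((Complex.continuous_ofReal.comp (continuous_const.mul continuous_id)).mul
      continuous_const)).mul hAc).intervalIntegrable _ _
  have hi2 : IntervalIntegrable (fun s => Complex.exp (((φ - ω) * s : ℝ) * Complex.I) * A s) volume 0 θ :=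
    ((Complex.continuous_exp.comp ((Complex.continuous_ofReal.comp (continuous_const.mul continuous_id)).mul
      continuous_const)).mul hAc).intervalIntegrable _ _
  have e : ∫ s in (0 : ℝ)..θ, (Real.cos (ω * s) : ℂ) * Complex.exp ((φ * s : ℝ) * Complex.I) * A s =
      (1 / 2 : ℂ) * (∫ s in (0 : ℝ)..θ, Complex.exp (((φ + ω) * s : ℝ) * Complex.I) * A s) +
        (1 / 2 : ℂ) * (∫ s in (0 : ℝ)..θ, Complex.exp (((φ - ω) * s : ℝ) * Complex.I) * A s) := by
    rw [intervalIntegral.integral_congr (fun s _ => hsplit s), intervalIntegral.integral_add (hi1.const_mul _)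
      (hi2.const_mul _), intervalIntegral.integral_const_mul, intervalIntegral.integral_const_mul]
  rw [e]
  -- the bound on each half
  set V : ℝ := ‖A 0‖ + ‖A θ‖ + ∫ s in (0 : ℝ)..θ, ‖A' s‖ with hV
  have hV0 : 0 ≤ V := by
    have : 0 ≤ ∫ s in (0 : ℝ)..θ, ‖A' s‖ := intervalIntegral.integral_nonneg hθ fun s _ => norm_nonneg _
    positivity
  have h1 := norm_integral_exp_mul_le hp0 hθ hA hA'
  have h2 := norm_integral_exp_mul_le hm0 hθ hA hA'
  have h1' : ‖∫ s in (0 : ℝ)..θ, Complex.exp (((φ + ω) * s : ℝ) * Complex.I) * A s‖ ≤ V / Δ :=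
    h1.trans (div_le_div_of_nonneg_left hV0 hΔ hp)
  have h2' : ‖∫ s in (0 : ℝ)..θ, Complex.exp (((φ - ω) * s : ℝ) * Complex.I) * A s‖ ≤ V / Δ :=
    h2.trans (div_le_div_of_nonneg_left hV0 hΔ hm)
  -- `V ≤ 2 sup + ∫‖A'‖`
  have hS0 : ‖A 0‖ ≤ ⨆ s ∈ Icc (0 : ℝ) θ, ‖A s‖ := norm_le_biSup hAc ⟨le_rfl, hθ⟩
  have hSθ : ‖A θ‖ ≤ ⨆ s ∈ Icc (0 : ℝ) θ, ‖A s‖ := norm_le_biSup hAc ⟨hθ, le_rfl⟩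
  have hVle : V ≤ 2 * (⨆ s ∈ Icc (0 : ℝ) θ, ‖A s‖) + ∫ s in (0 : ℝ)..θ, ‖A' s‖ := by
    rw [hV]; linarith
  have hhalf : ‖(1 / 2 : ℂ)‖ = 1 / 2 := by norm_num
  calc ‖(1 / 2 : ℂ) * (∫ s in (0 : ℝ)..θ, Complex.exp (((φ + ω) * s : ℝ) * Complex.I) * A s) +
        (1 / 2 : ℂ) * (∫ s in (0 : ℝ)..θ, Complex.exp (((φ - ω) * s : ℝ) * Complex.I) * A s)‖
      ≤ 1 / 2 * (V / Δ) + 1 / 2 * (V / Δ) := by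
        refine (norm_add_le _ _).trans (add_le_add ?_ ?_)
        · rw [norm_mul, hhalf]; exact mul_le_mul_of_nonneg_left h1' (by norm_num)
        · rw [norm_mul, hhalf]; exact mul_le_mul_of_nonneg_left h2' (by norm_num)
    _ = V / Δ := by ring
    _ ≤ (2 * (⨆ s ∈ Icc (0 : ℝ) θ, ‖A s‖) + ∫ s in (0 : ℝ)..θ, ‖A' s‖) / Δ :=
        div_le_div_of_nonneg_right hVle hΔ.le

/-- **The detuned `sin`-oscillator response** (companion of `norm_integral_cos_mul_exp_mul_le`, same
bound): for `0 < Δ ≤ |φ| − |ω|`, `θ ≥ 0` and a `C¹` envelope `A`,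
`‖∫₀^θ sin(ωs) e^{iφs} A(s) ds‖ ≤ (2 sup_{s∈[0,θ]}‖A s‖ + ∫₀^θ ‖A′‖)/Δ`
(`sin(ωs)e^{iφs} = (e^{i(φ−ω)s} − e^{i(φ+ω)s})·(i/2)`). The velocity component `sin(ωs)/ω` of a stable
block's propagator is this divided by `ω`.
[cite: Grafakos2014, Cor. 2.6.8 (k = 1) applied to the two linear phases (φ ± ω)s] -/
theorem norm_integral_sin_mul_exp_mul_le :
    ∀ (ω φ Δ θ : ℝ) (A : ℝ → ℂ) (A' : ℝ → ℂ), 0 < Δ → 0 ≤ θ → Δ ≤ |φ| - |ω| →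
      (∀ s, HasDerivAt A (A' s) s) → Continuous A' →
        ‖∫ s in (0 : ℝ)..θ, (Real.sin (ω * s) : ℂ) * Complex.exp ((φ * s : ℝ) * Complex.I) * A s‖
          ≤ (2 * (⨆ s ∈ Set.Icc (0 : ℝ) θ, ‖A s‖) + ∫ s in (0 : ℝ)..θ, ‖A' s‖) / Δ := by
  intro ω φ Δ θ A A' hΔ hθ hdet hA hA'
  have hAc : Continuous A := continuous_of_hasDerivAt hA
  have hp : Δ ≤ |φ + ω| := hdet.trans (by simpa using abs_sub_abs_le_abs_sub φ (-ω))
  have hm : Δ ≤ |φ - ω| := hdet.trans (abs_sub_abs_le_abs_sub φ ω)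
  have hp0 : φ + ω ≠ 0 := fun h => by rw [h, abs_zero] at hp; linarith
  have hm0 : φ - ω ≠ 0 := fun h => by rw [h, abs_zero] at hm; linarith
  -- `sin(ωs) e^{iφs} A = (I/2) e^{i(φ−ω)s} A − (I/2) e^{i(φ+ω)s} A`
  have hsplit : ∀ s : ℝ, (Real.sin (ω * s) : ℂ) * Complex.exp ((φ * s : ℝ) * Complex.I) * A s =
      (Complex.I / 2) * (Complex.exp (((φ - ω) * s : ℝ) * Complex.I) * A s) -
        (Complex.I / 2) * (Complex.exp (((φ + ω) * s : ℝ) * Complex.I) * A s) := by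
    intro s
    have hc : (Real.sin (ω * s) : ℂ) = (Complex.exp (-((ω * s : ℝ) : ℂ) * Complex.I) -
        Complex.exp ((ω * s : ℝ) * Complex.I)) * Complex.I / 2 := by
      rw [Complex.ofReal_sin, ← Complex.two_sin]; ring
    rw [hc]
    have e1 : Complex.exp (((φ + ω) * s : ℝ) * Complex.I) =
        Complex.exp ((ω * s : ℝ) * Complex.I) * Complex.exp ((φ * s : ℝ) * Complex.I) := by
      rw [← Complex.exp_add]; push_cast; ring_nf
    have e2 : Complex.exp (((φ - ω) * s : ℝ) * Complex.I) =
        Complex.exp (-((ω * s : ℝ) : ℂ) * Complex.I) * Complex.exp ((φ * s : ℝ) * Complex.I) := by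
      rw [← Complex.exp_add]; push_cast; ring_nf
    rw [e1, e2]; ring
  have hi1 : IntervalIntegrable (fun s => Complex.exp (((φ - ω) * s : ℝ) * Complex.I) * A s) volume 0 θ :=
    ((Complex.continuous_exp.comp ((Complex.continuous_ofReal.comp (continuous_const.mul continuous_id)).mul
      continuous_const)).mul hAc).intervalIntegrable _ _
  have hi2 : IntervalIntegrable (fun s => Complex.exp (((φ + ω) * s : ℝ) * Complex.I) * A s) volume 0 θ :=
    ((Complex.continuous_exp.comp ((Complex.continuous_ofReal.comp (continuous_const.mul continuous_id)).mul
      continuous_const)).mul hAc).intervalIntegrable _ _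
  have e : ∫ s in (0 : ℝ)..θ, (Real.sin (ω * s) : ℂ) * Complex.exp ((φ * s : ℝ) * Complex.I) * A s =
      (Complex.I / 2) * (∫ s in (0 : ℝ)..θ, Complex.exp (((φ - ω) * s : ℝ) * Complex.I) * A s) -
        (Complex.I / 2) * (∫ s in (0 : ℝ)..θ, Complex.exp (((φ + ω) * s : ℝ) * Complex.I) * A s) := by
    rw [intervalIntegral.integral_congr (fun s _ => hsplit s), intervalIntegral.integral_sub (hi1.const_mul _)
      (hi2.const_mul _), intervalIntegral.integral_const_mul, intervalIntegral.integral_const_mul]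
  rw [e]
  set V : ℝ := ‖A 0‖ + ‖A θ‖ + ∫ s in (0 : ℝ)..θ, ‖A' s‖ with hV
  have hV0 : 0 ≤ V := by
    have : 0 ≤ ∫ s in (0 : ℝ)..θ, ‖A' s‖ := intervalIntegral.integral_nonneg hθ fun s _ => norm_nonneg _
    positivity
  have h1' : ‖∫ s in (0 : ℝ)..θ, Complex.exp (((φ - ω) * s : ℝ) * Complex.I) * A s‖ ≤ V / Δ :=
    (norm_integral_exp_mul_le hm0 hθ hA hA').trans (div_le_div_of_nonneg_left hV0 hΔ hm)
  have h2' : ‖∫ s in (0 : ℝ)..θ, Complex.exp (((φ + ω) * s : ℝ) * Complex.I) * A s‖ ≤ V / Δ :=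
    (norm_integral_exp_mul_le hp0 hθ hA hA').trans (div_le_div_of_nonneg_left hV0 hΔ hp)
  have hS0 : ‖A 0‖ ≤ ⨆ s ∈ Icc (0 : ℝ) θ, ‖A s‖ := norm_le_biSup hAc ⟨le_rfl, hθ⟩
  have hSθ : ‖A θ‖ ≤ ⨆ s ∈ Icc (0 : ℝ) θ, ‖A s‖ := norm_le_biSup hAc ⟨hθ, le_rfl⟩
  have hVle : V ≤ 2 * (⨆ s ∈ Icc (0 : ℝ) θ, ‖A s‖) + ∫ s in (0 : ℝ)..θ, ‖A' s‖ := by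
    rw [hV]; linarith
  have hhalf : ‖(Complex.I / 2 : ℂ)‖ = 1 / 2 := by
    rw [norm_div, Complex.norm_I]; norm_num
  calc ‖(Complex.I / 2) * (∫ s in (0 : ℝ)..θ, Complex.exp (((φ - ω) * s : ℝ) * Complex.I) * A s) -
        (Complex.I / 2) * (∫ s in (0 : ℝ)..θ, Complex.exp (((φ + ω) * s : ℝ) * Complex.I) * A s)‖
      ≤ 1 / 2 * (V / Δ) + 1 / 2 * (V / Δ) := by
        refine (norm_sub_le _ _).trans (add_le_add ?_ ?_)
        · rw [norm_mul, hhalf]; exact mul_le_mul_of_nonneg_left h1' (by norm_num)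
        · rw [norm_mul, hhalf]; exact mul_le_mul_of_nonneg_left h2' (by norm_num)
    _ = V / Δ := by ring
    _ ≤ (2 * (⨆ s ∈ Icc (0 : ℝ) θ, ‖A s‖) + ∫ s in (0 : ℝ)..θ, ‖A' s‖) / Δ :=
        div_le_div_of_nonneg_right hVle hΔ.le

end LinearPhase

end Literature.Analysis.Fourier

end
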